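import Summits.QuantumFields.BalabanUV.Beta.GAN24.CombEEWordTransfer
import Summits.QuantumFields.BalabanUV.Beta.GAN24.CombVHEWordsZeroStep
import Summits.QuantumFields.BalabanUV.Beta.GAN24.ExchangeLatticeWordSlot

/-!
# `BalabanUV.Beta.GAN24.CombEEWordTransferStep` — binder row G-an2-4 ∕ (CONV-C), TRANSFER-III, the (III′) (C)-campaign's supplier `hB0` AT LEVELS `j + 1 ≥ 1`:
# **THE `E′ ⊗ E′` WORD AT THE COMB DATA, LEVEL `j+1`, IS THE WORD OVER THE UNTRANSPORTED CUBIC SECTOR** — leaf-01 g86's E `CombEEWordTransfer.sum_box_transported_ee_word_eq` (both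
# half-vertices over the transported level-`0` table `𝒯(cE • wilsonA)`; its header: «levels ≥ 1 untouched») re-run with F6 `CombForcingSectorSplit.dM_comb_succ_split`'s level-`(j+1)`
# sector `𝒯(c₀ • e3OfK Lc G_j M)` for a GENERIC local, block-covariant member `M` (at the comb data `M = 𝒯 S̃comb_j`, an1's record): in the zero mode the two-face word of `X̃♮_{j+1}` with
# both half-vertices over `𝒯T`, `T = c₀ • e3OfK Lc G_j M`, equals the same word over `T` — every `j`, every transport root, all units, ALL axes.  Mechanism VERBATIM E's: the outer legs
# drop (A1); the cubic sector is pure ff (C `sector_inr_left ∕ _right`), so the word reduces to `Σ'_{y₁} Σ_a j_c(a,y₁)·G(a,y₁)` (E §1); the resummed right current loses its slot transport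
# (A2 §1) and is `Lc`-periodic bounded (C `sectorCurrent_periodic`), so in `Y = Ψ̂X̃Ψ̂ᵀ` the right `Ψ̂ᵀ` drops and the left `Ψ̂` fixes the periodic response (E §2–§3); finally the left
# family loses its slot transport in the zero mode (D1 §3 with C `sector_translate`).  NO (D)∕(Z) input is needed for this word.
# (G-an2-4 ∕ (CONV-C) OWNER `b2b-balaban-gan24-p1`, gen 53; journal [GAN24P1-G53-INTENT-2])

NOT IN PRINT; OUR BOOKKEEPING ([folklore] BY NAME over leaf-01 g86 A1 `TransportedWordTools` ∕ A2 `TransportedWordReduction` ∕ D1 `CombBorderWordTools` ∕ E `CombEEWordTransfer` §1–§3 ∕ C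
`CombVHEWordsZeroStep` §1 ∕ §3, leaf-06's `ExchangeLatticeWordSlot.vertexOfK_inl_inr_of_ff ∕ _inr_inl_of_ff`, leaf-04's `VHWordsZeroLatticeStep.current_bounded`; 0 `def`, 0 cited fact,
0 `def … : Prop`, 0 sorry).  HONEST FRAMING (cell contract, verbatim): «discharging `BetaPertH` makes Bałaban's UV stability UNCONDITIONAL — a real constructive-QFT result; it is NOT the
continuum limit and NOT the Clay problem.»  HONEST DEPENDENCY (verbatim): «continuum YM on T⁴ ⇐ BetaPertH ∧ nine spine estimates (0/9 proved); BetaPertH ⇐ (D1) ∧ (D4) ∧ CAP+tail; G-an2-4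
gates asym, D1 and NE2/3/4.»

## What is proved (generic `d`, `[NeZero Lc]`, `1 ≤ Lc`, in-block kernel root `toSite rb`, `G_j = coDressKBmAt (toSite rb) Lc (KInvStep Lc j)`, `X̃♮_{j+1}`, `T := κ t ↦ c₀ • e3OfK Lc G_j M κ t`, all units)
* §1 **`sum_box_transported_sector_ee_word_eq`** (every `j`, any transport root `r ∈ box`, any `c₀`, ALL axes; `M` local, block-covariant):
  `Σ_{c∈box Lc} Σ'_{u′} FF[(vertexOfK X̃♮_{j+1} Lc (unitS (𝒯T)) μ c ∘ X̃♮_{j+1}) ∘ vertexOfK X̃♮_{j+1} Lc (unitS (𝒯T)) ν u′] = Σ_{c∈box Lc} Σ'_{u′} FF[(vertexOfK X̃♮_{j+1} Lc (unitS T) μ c ∘ X̃♮_{j+1}) ∘ vertexOfK X̃♮_{j+1} Lc (unitS T) ν u′]`.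
* §2 AT THE COMB DATA (`r = rb = ctrOff (d+1) Lc`, root `ctr (d+1) Lc`, an1's record `tabs = symTablesAn1S2 d Lc cΛt`, `M = 𝒯 (ScombOf tabs cE cVH cΛ j)`, `c₀ = cE·wE_{j+1}`):
  **`sum_box_comb_ee_word_succ_eq`** — F6 `dM_comb_succ_split`'s `V^E′_c ⊗ V^E′_{u′}` zero-mode word at level `j+1` equals the `E ⊗ E` word over the UNTRANSPORTED comb cubic sector
  `W_j := (cE·wE_{j+1}) • e3OfK Lc G_j (𝒯 S̃comb_j)` through `X̃_{j+1}` — the object whose antisymmetric PAIR FORM (J2's twin at the comb data) is the remaining open letter of `hB0 (j+1)`.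
WHAT THIS IS NOT: NO value and NO pair form of the untransported word (J2 at the comb — OPEN); NOT `hB0`; NEVER «G-an2-4 closed» as (CONV-C); NOT D1, NOT `BetaPertH`, NOT continuum, NOT Clay.
2026-08-27; no existing file touched.
-/

noncomputable section

open Finset
open scoped BigOperators
open Literature.MathematicalPhysics.QuantumFieldTheory
open Literature.MathematicalPhysics.QuantumFieldTheory.Balaban1983to89
open Literature.MathematicalPhysics.QuantumFieldTheory.Balaban1983to89.Beta
open ExpKernelCalculus (Site MKer comp shiftK Decays BiLoc VertexFamily)
open BalabanStepJetsSucc (biLoc_comp_right wE)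
open AffineAveraging (box toSite)
open AveragingContoursRooted (ctr ctrOff ctrOff_mem_box)
open OneStepResolventKernel (Fib LocStencil decays_mono biLoc_mono)
open OneStepKernelFamily (KInvStep vertexOfK vertexFamily_vertexOfK decays_KInvStep)
open Summit.QuantumFields.BalabanUV.Beta.TameKernelCalculus (trK trK_apply decays_trK Spr)
open Summit.QuantumFields.BalabanUV.Beta.BorderedHessian (sgnK)
open Summit.QuantumFields.BalabanUV.Beta.AxialDressingRooted (coDressKBmAt decays_coDressKBmAt)
open Summit.QuantumFields.BalabanUV.Beta.HessKerDressedUnits (unitK unitS decays_unitK locStencil_unitS)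
open Summit.QuantumFields.BalabanUV.Beta.SpineRooted (e3OfK)
open Summit.QuantumFields.BalabanUV.Beta.SymSecondOrderTablesAn1 (symTablesAn1S2)
open Summit.QuantumFields.BalabanUV.Beta.CombChartStepJets (ScombOf)
open Summit.QuantumFields.BalabanUV.Beta.SymCorrectorKernel (psiKS spr_psiKS)
open Summit.QuantumFields.BalabanUV.Beta.SymCorrectorFace (slotPsiS)
open Summit.QuantumFields.BalabanUV.Beta.SymCorrectorSockets (locStencil_slotPsiS)
open Summit.QuantumFields.BalabanUV.Beta.GAN24.ExchangeSlotResum (face_weight_periodic)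
open Summit.QuantumFields.BalabanUV.Beta.GAN24.ExchangeLatticeWordSlot (vertexOfK_inl_inr_of_ff vertexOfK_inr_inl_of_ff)
open Summit.QuantumFields.BalabanUV.Beta.GAN24.VHWordsZeroLatticeStep (current_bounded)
open Summit.QuantumFields.BalabanUV.Beta.GAN24.CombTransportedBorder (pos_Lc)
open Summit.QuantumFields.BalabanUV.Beta.GAN24.CombSlotResumTransport (vertexOfK_unitS_transport_eq_conj)
open Summit.QuantumFields.BalabanUV.Beta.GAN24.TransportedWordTools (exists_decays_sandwich tsum_twoFace_conj_word_eq vertexOfK_unitS_slotPsiS_entry_eq_zero)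
open Summit.QuantumFields.BalabanUV.Beta.GAN24.TransportedWordReduction (tsum_prod_weight_vertexOfK_dressedStep_slotPsiS)
open Summit.QuantumFields.BalabanUV.Beta.GAN24.CombBorderWordTools (sum_box_leftFamily_slotPsiS_eq)
open Summit.QuantumFields.BalabanUV.Beta.GAN24.CombEEWordTransfer (tsum_ffOnly_word_eq_reduced tsum_sum_sandwich_inl_inl_mul_periodic dressedResponse_periodic)
open Summit.QuantumFields.BalabanUV.Beta.GAN24.CombVHEWordsZeroStep (sector_inr_left sector_inr_right exists_locStencil_sector sector_translate sectorCurrent_periodic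
  exists_locStencil_transport_ScombOf transport_ScombOf_translate)

namespace Summit.QuantumFields.BalabanUV.Beta.GAN24.CombEEWordTransferStep

variable {d : ℕ} {Lc : ℕ} [NeZero Lc] {rb : Fin (d + 1) → ℕ}

/-! ## §1 The transported `E′ ⊗ E′` word of the cubic sector is the untransported word -/

section Words

variable {r : Fin (d + 1) → ℕ} {M : Fin (d + 1) → Site (d + 1) → MKer (d + 1) (Fib d)} {CM δM : ℝ} {μ ν α β : Fin (d + 1)}

/-- NOT IN PRINT; OUR BOOKKEEPING ([folklore]; E §4 AT LEVEL `j+1` FOR THE CUBIC SECTOR OF A GENERIC MEMBER).  Every `j`, in-block kernel root `toSite rb`, ANY transport root `r ∈ box`,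
`1 ≤ Lc`, all units, any `c₀`, ALL axes; `M` local and block-covariant; `T = c₀ • e3OfK Lc G_j M`, `𝒯T κ u = Ψ̂ᵀ∘slotPsiS r Lc T κ u∘Ψ̂`:
`Σ_{c∈box Lc} Σ'_{u′} FF[(vertexOfK X̃♮_{j+1} Lc (unitS (𝒯T)) μ c ∘ X̃♮_{j+1}) ∘ vertexOfK X̃♮_{j+1} Lc (unitS (𝒯T)) ν u′] = Σ_{c∈box Lc} Σ'_{u′} FF[(vertexOfK X̃♮_{j+1} Lc (unitS T) μ c ∘ X̃♮_{j+1}) ∘ vertexOfK X̃♮_{j+1} Lc (unitS T) ν u′]`. -/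
theorem sum_box_transported_sector_ee_word_eq (hLc : 1 ≤ Lc) (hrb : rb ∈ box (d + 1) Lc) (hr : r ∈ box (d + 1) Lc) (sf sm c₀ : ℝ) (j : ℕ)
    (hM : LocStencil M CM δM) (hδM : 0 < δM) (hMt : ∀ (κ : Fin (d + 1)) (u t : Site (d + 1)), M κ (u + (Lc : ℤ) • t) = shiftK (-((Lc : ℤ) • t)) (M κ u)) :
    ∑ c ∈ box (d + 1) Lc, ∑' u' : Site (d + 1), ∑' yw : Site (d + 1) × Site (d + 1), (if yw.1 α % (Lc : ℤ) = (Lc : ℤ) - 1 then (1 : ℝ) else 0) * (if yw.2 β % (Lc : ℤ) = (Lc : ℤ) - 1 then (1 : ℝ) else 0) *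
        comp (comp (vertexOfK (unitK sf sm (coDressKBmAt (toSite rb) Lc (KInvStep (d := d) Lc (j + 1)))) Lc
            (unitS sf sm (fun κ u => comp (comp (trK (psiKS r Lc)) (slotPsiS r Lc
              (fun κ t => c₀ • e3OfK Lc (coDressKBmAt (toSite rb) Lc (KInvStep (d := d) Lc j)) M κ t) κ u)) (psiKS r Lc))) μ (toSite c))
          (unitK sf sm (coDressKBmAt (toSite rb) Lc (KInvStep (d := d) Lc (j + 1)))))
          (vertexOfK (unitK sf sm (coDressKBmAt (toSite rb) Lc (KInvStep (d := d) Lc (j + 1)))) Lc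
            (unitS sf sm (fun κ u => comp (comp (trK (psiKS r Lc)) (slotPsiS r Lc
              (fun κ t => c₀ • e3OfK Lc (coDressKBmAt (toSite rb) Lc (KInvStep (d := d) Lc j)) M κ t) κ u)) (psiKS r Lc))) ν u') yw.1 yw.2 (Sum.inl α) (Sum.inl β) =
      ∑ c ∈ box (d + 1) Lc, ∑' u' : Site (d + 1), ∑' yw : Site (d + 1) × Site (d + 1), (if yw.1 α % (Lc : ℤ) = (Lc : ℤ) - 1 then (1 : ℝ) else 0) * (if yw.2 β % (Lc : ℤ) = (Lc : ℤ) - 1 then (1 : ℝ) else 0) *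
        comp (comp (vertexOfK (unitK sf sm (coDressKBmAt (toSite rb) Lc (KInvStep (d := d) Lc (j + 1)))) Lc
            (unitS sf sm (fun κ t => c₀ • e3OfK Lc (coDressKBmAt (toSite rb) Lc (KInvStep (d := d) Lc j)) M κ t)) μ (toSite c))
          (unitK sf sm (coDressKBmAt (toSite rb) Lc (KInvStep (d := d) Lc (j + 1)))))
          (vertexOfK (unitK sf sm (coDressKBmAt (toSite rb) Lc (KInvStep (d := d) Lc (j + 1)))) Lc
            (unitS sf sm (fun κ t => c₀ • e3OfK Lc (coDressKBmAt (toSite rb) Lc (KInvStep (d := d) Lc j)) M κ t)) ν u') yw.1 yw.2 (Sum.inl α) (Sum.inl β) := by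
  classical
  have hLc0 : 0 < Lc := hLc
  set X := unitK sf sm (coDressKBmAt (toSite rb) Lc (KInvStep (d := d) Lc (j + 1))) with hX
  set T : Fin (d + 1) → Site (d + 1) → MKer (d + 1) (Fib d) := fun κ t => c₀ • e3OfK Lc (coDressKBmAt (toSite rb) Lc (KInvStep (d := d) Lc j)) M κ t with hTdef
  -- the untransported product-form current and its response
  set t : Fin (d + 1) → Site (d + 1) → ℝ := fun b z => ∑' uw : Site (d + 1) × Site (d + 1), (if uw.2 β % (Lc : ℤ) = (Lc : ℤ) - 1 then (1 : ℝ) else 0) *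
    vertexOfK X Lc (unitS sf sm T) ν uw.1 z uw.2 (Sum.inl b) (Sum.inl β) with htdef
  have hper : ∀ (b : Fin (d + 1)) (z s : Site (d + 1)), t b (z + (Lc : ℤ) • s) = t b z := fun b z s => by
    simp only [htdef, hX, hTdef]
    exact sectorCurrent_periodic (rb := rb) hLc sf sm c₀ j hMt ν β (Sum.inl b) (Sum.inl β) z s
  have htb := fun b z => current_bounded (Lc := Lc) hper b z
  set G : Fin (d + 1) → Site (d + 1) → ℝ := fun κ y => ∑' z : Site (d + 1), ∑ b : Fin (d + 1), X y z (Sum.inl κ) (Sum.inl b) * t b z with hGdef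
  have hGper : ∀ (κ : Fin (d + 1)) (y s : Site (d + 1)), G κ (y + (Lc : ℤ) • s) = G κ y := fun κ y s => by
    simp only [hGdef, hX]
    exact dressedResponse_periodic (rb := rb) hLc sf sm (j + 1) hper κ y s
  have hGb := fun κ y => current_bounded (Lc := Lc) hGper κ y
  -- common-rate data
  obtain ⟨δK, CK, hδK, hCK, hXd⟩ := decays_coDressKBmAt hLc hrb (decays_KInvStep (d := d) (Lc := Lc) (j + 1))
  have hXu : Decays X (max |sf| |sm| * CK * max |sf| |sm|) δK := decays_unitK (sf := sf) (sm := sm) hXd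
  have hCX : 0 ≤ max |sf| |sm| * CK * max |sf| |sm| := by positivity
  obtain ⟨CT, δT, hδT, hT0⟩ := exists_locStencil_sector (rb := rb) (d := d) hrb c₀ j hM hδM
  have hCT : 0 ≤ CT := (hT0 0 0).nonneg (Sum.inl 0)
  set δ₁ : ℝ := min δK δT with hδ₁
  have hδ₁0 : 0 < δ₁ := lt_min hδK hδT
  have hX1 : Decays X (max |sf| |sm| * CK * max |sf| |sm|) δ₁ := decays_mono hXu hCX le_rfl (min_le_left _ _)
  have hXspr : Spr X := ⟨_, _, hδ₁0, hX1⟩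
  have hT1 : LocStencil T CT δ₁ := fun κ' u => biLoc_mono (hT0 κ' u) hCT (min_le_right _ _)
  have hTs := locStencil_slotPsiS (d := d) hLc0 r hT1 hδ₁0.le
  have hV := vertexFamily_vertexOfK (N := Lc) hX1 hCX (locStencil_unitS (sf := sf) (sm := sm) hT1) hδ₁0 le_rfl
  have hVs := vertexFamily_vertexOfK (N := Lc) hX1 hCX (locStencil_unitS (sf := sf) (sm := sm) hTs) hδ₁0 le_rfl
  have h₁ : ∀ y : Site (d + 1), |(if y α % (Lc : ℤ) = (Lc : ℤ) - 1 then (1 : ℝ) else 0)| ≤ 1 := fun y => by split_ifs <;> simp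
  have h₂ : ∀ w : Site (d + 1), |(if w β % (Lc : ℤ) = (Lc : ℤ) - 1 then (1 : ℝ) else 0)| ≤ 1 := fun w => by split_ifs <;> simp
  have hTfm : ∀ (κ : Fin (d + 1)) (t' x z : Site (d + 1)) (α' m : Fin (d + 1)), T κ t' x z (Sum.inl α') (Sum.inr m) = 0 :=
    fun κ t' x z α' m => by rw [hTdef]; exact sector_inr_right (rb := rb) (d := d) c₀ j κ t' x z (Sum.inl α') m
  have hTmf : ∀ (κ : Fin (d + 1)) (t' x z : Site (d + 1)) (m b' : Fin (d + 1)), T κ t' x z (Sum.inr m) (Sum.inl b') = 0 :=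
    fun κ t' x z m b' => by rw [hTdef]; exact sector_inr_left (rb := rb) (d := d) c₀ j κ t' x z m (Sum.inl b')
  have hTcov : ∀ (κ : Fin (d + 1)) (u s : Site (d + 1)), T κ (u + (Lc : ℤ) • s) = shiftK (-((Lc : ℤ) • s)) (T κ u) :=
    fun κ u s => by rw [hTdef]; exact sector_translate (rb := rb) (d := d) c₀ j hMt κ u ((Lc : ℤ) • s)
  obtain ⟨CY, hCY, hY⟩ := exists_decays_sandwich hLc0 hr hX1 hδ₁0
  -- LEFT side, per cell bond: outer legs drop, then the reduced form with the sandwich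
  have hL : ∀ c : Site (d + 1), (∑' u' : Site (d + 1), ∑' yw : Site (d + 1) × Site (d + 1), (if yw.1 α % (Lc : ℤ) = (Lc : ℤ) - 1 then (1 : ℝ) else 0) * (if yw.2 β % (Lc : ℤ) = (Lc : ℤ) - 1 then (1 : ℝ) else 0) *
        comp (comp (vertexOfK X Lc (unitS sf sm (fun κ u => comp (comp (trK (psiKS r Lc)) (slotPsiS r Lc T κ u)) (psiKS r Lc))) μ c) X)
          (vertexOfK X Lc (unitS sf sm (fun κ u => comp (comp (trK (psiKS r Lc)) (slotPsiS r Lc T κ u)) (psiKS r Lc))) ν u') yw.1 yw.2 (Sum.inl α) (Sum.inl β))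
      = ∑' y₁ : Site (d + 1), ∑ a : Fin (d + 1), (∑' y : Site (d + 1), (if y α % (Lc : ℤ) = (Lc : ℤ) - 1 then (1 : ℝ) else 0) *
          vertexOfK X Lc (unitS sf sm (slotPsiS r Lc T)) μ c y y₁ (Sum.inl α) (Sum.inl a)) * G a y₁ := by
    intro c
    have e : ∀ u' : Site (d + 1), (∑' yw : Site (d + 1) × Site (d + 1), (if yw.1 α % (Lc : ℤ) = (Lc : ℤ) - 1 then (1 : ℝ) else 0) * (if yw.2 β % (Lc : ℤ) = (Lc : ℤ) - 1 then (1 : ℝ) else 0) *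
          comp (comp (vertexOfK X Lc (unitS sf sm (fun κ u => comp (comp (trK (psiKS r Lc)) (slotPsiS r Lc T κ u)) (psiKS r Lc))) μ c) X)
            (vertexOfK X Lc (unitS sf sm (fun κ u => comp (comp (trK (psiKS r Lc)) (slotPsiS r Lc T κ u)) (psiKS r Lc))) ν u') yw.1 yw.2 (Sum.inl α) (Sum.inl β)) =
        ∑' yw : Site (d + 1) × Site (d + 1), (if yw.1 α % (Lc : ℤ) = (Lc : ℤ) - 1 then (1 : ℝ) else 0) * (if yw.2 β % (Lc : ℤ) = (Lc : ℤ) - 1 then (1 : ℝ) else 0) *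
          comp (comp (vertexOfK X Lc (unitS sf sm (slotPsiS r Lc T)) μ c) (comp (comp (psiKS r Lc) X) (trK (psiKS r Lc))))
            (vertexOfK X Lc (unitS sf sm (slotPsiS r Lc T)) ν u') yw.1 yw.2 (Sum.inl α) (Sum.inl β) := by
      intro u'
      rw [vertexOfK_unitS_transport_eq_conj hLc0 hr hXspr sf sm hT1 hδ₁0 μ c, vertexOfK_unitS_transport_eq_conj hLc0 hr hXspr sf sm hT1 hδ₁0 ν u']
      exact tsum_twoFace_conj_word_eq hLc0 hr (hVs μ c) (half_pos hδ₁0) (hVs ν u') (half_pos hδ₁0) hX1 hδ₁0 h₁ (fun y s => face_weight_periodic Lc α y s) h₂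
        (fun w s => face_weight_periodic Lc β w s) _ _
    rw [tsum_congr e]
    rw [tsum_ffOnly_word_eq_reduced (N := Lc) (hVs μ c) (half_pos hδ₁0)
      (fun y z α' m => vertexOfK_unitS_slotPsiS_entry_eq_zero r X Lc sf sm (fun κ t' x z' => hTfm κ t' x z' α' m) μ c y z) hY (by positivity) (fun u' => hVs ν u') (half_pos hδ₁0)
      (fun u' z w m => vertexOfK_unitS_slotPsiS_entry_eq_zero r X Lc sf sm (fun κ t' x z' => hTmf κ t' x z' m β) ν u' z w) h₁ h₂ (t := t)
      (fun b z => by rw [htdef, hX]; exact tsum_prod_weight_vertexOfK_dressedStep_slotPsiS hLc hrb sf sm (j + 1) ν r hT1 hδ₁0 h₂ z (Sum.inl b) (Sum.inl β)) htb α]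
    refine tsum_congr fun y₁ => Finset.sum_congr rfl fun a _ => ?_
    congr 1
    rw [hGdef]
    exact tsum_sum_sandwich_inl_inl_mul_periodic hLc0 hr hXu hδK htb hper (fun κ y s => hGper κ y s) y₁ a
  -- RIGHT side, per cell bond: the reduced form with the bare kernel
  have hR : ∀ c : Site (d + 1), (∑' u' : Site (d + 1), ∑' yw : Site (d + 1) × Site (d + 1), (if yw.1 α % (Lc : ℤ) = (Lc : ℤ) - 1 then (1 : ℝ) else 0) * (if yw.2 β % (Lc : ℤ) = (Lc : ℤ) - 1 then (1 : ℝ) else 0) *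
        comp (comp (vertexOfK X Lc (unitS sf sm T) μ c) X) (vertexOfK X Lc (unitS sf sm T) ν u') yw.1 yw.2 (Sum.inl α) (Sum.inl β))
      = ∑' y₁ : Site (d + 1), ∑ a : Fin (d + 1), (∑' y : Site (d + 1), (if y α % (Lc : ℤ) = (Lc : ℤ) - 1 then (1 : ℝ) else 0) *
          vertexOfK X Lc (unitS sf sm T) μ c y y₁ (Sum.inl α) (Sum.inl a)) * G a y₁ := by
    intro c
    rw [tsum_ffOnly_word_eq_reduced (N := Lc) (hV μ c) (half_pos hδ₁0) (fun y z α' m => vertexOfK_inl_inr_of_ff (S := T) (fun κ v y' z' a m' => hTfm κ v y' z' a m') X Lc sf sm μ c y z α' m)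
      hX1 hδ₁0 (fun u' => hV ν u') (half_pos hδ₁0) (fun u' z w m => vertexOfK_inr_inl_of_ff (S := T) (fun κ v y' z' m' b' => hTmf κ v y' z' m' b') X Lc sf sm ν u' z w m β)
      h₁ h₂ (t := t) (fun b z => by rw [htdef]) htb α]
  rw [Finset.sum_congr rfl fun c _ => hL (toSite c), Finset.sum_congr rfl fun c _ => hR (toSite c), hX]
  -- the cell sum: the left family loses its slot transport
  exact sum_box_leftFamily_slotPsiS_eq (μ := μ) (γ := α) hLc hrb sf sm (j + 1) r hT0 hδT hTcov hGb hGper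

end Words

/-! ## §2 At the comb data: the transported folded comb member of an1's record -/

section Comb

variable {μ ν α β : Fin (d + 1)}

/-- NOT IN PRINT; OUR BOOKKEEPING ([folklore]; THE `E′ ⊗ E′` WORD OF F6 `dM_comb_succ_split` AT LEVEL `j+1` = THE `E ⊗ E` WORD OVER THE UNTRANSPORTED COMB CUBIC SECTOR).  At the comb root
`ρ_c = ctr (d+1) Lc` (`= toSite (ctrOff (d+1) Lc)`, `rfl`), transport `𝒯 = Ψ̂_Sᵀ∘slotPsiS (ctrOff) Lc∘Ψ̂_S`, record `tabs = symTablesAn1S2 d Lc cΛt`, all units, pins `cE cVH cΛ`, every `j`, ALL axes: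
`Σ_{c∈box Lc} Σ'_{u′} FF[(vertexOfK X̃_{j+1} Lc (unitS (𝒯W_j)) μ c ∘ X̃_{j+1}) ∘ vertexOfK X̃_{j+1} Lc (unitS (𝒯W_j)) ν u′] = Σ_{c∈box Lc} Σ'_{u′} FF[(vertexOfK X̃_{j+1} Lc (unitS W_j) μ c ∘ X̃_{j+1}) ∘ vertexOfK X̃_{j+1} Lc (unitS W_j) ν u′]`,
`W_j = (cE·wE_{j+1}) • e3OfK Lc G_j (𝒯 S̃comb_j)` — §1 at `r = rb = ctrOff (d+1) Lc`, `M = 𝒯 S̃comb_j` (C `exists_locStencil_transport_ScombOf ∕ transport_ScombOf_translate`). -/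
theorem sum_box_comb_ee_word_succ_eq (sf sm cΛt cE cVH cΛ : ℝ) (j : ℕ) :
    ∑ c ∈ box (d + 1) Lc, ∑' u' : Site (d + 1), ∑' yw : Site (d + 1) × Site (d + 1), (if yw.1 α % (Lc : ℤ) = (Lc : ℤ) - 1 then (1 : ℝ) else 0) * (if yw.2 β % (Lc : ℤ) = (Lc : ℤ) - 1 then (1 : ℝ) else 0) *
        comp (comp (vertexOfK (unitK sf sm (coDressKBmAt (ctr (d + 1) Lc) Lc (KInvStep (d := d) Lc (j + 1)))) Lc
            (unitS sf sm (fun κ u => comp (comp (trK (psiKS (ctrOff (d + 1) Lc) Lc)) (slotPsiS (ctrOff (d + 1) Lc) Lc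
              (fun κ t => (cE * wE d Lc (j + 1)) • e3OfK Lc (coDressKBmAt (ctr (d + 1) Lc) Lc (KInvStep (d := d) Lc j))
                (fun κ u => comp (comp (trK (psiKS (ctrOff (d + 1) Lc) Lc)) (slotPsiS (ctrOff (d + 1) Lc) Lc (ScombOf (symTablesAn1S2 d Lc cΛt) cE cVH cΛ j) κ u))
                  (psiKS (ctrOff (d + 1) Lc) Lc)) κ t) κ u)) (psiKS (ctrOff (d + 1) Lc) Lc))) μ (toSite c))
          (unitK sf sm (coDressKBmAt (ctr (d + 1) Lc) Lc (KInvStep (d := d) Lc (j + 1)))))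
          (vertexOfK (unitK sf sm (coDressKBmAt (ctr (d + 1) Lc) Lc (KInvStep (d := d) Lc (j + 1)))) Lc
            (unitS sf sm (fun κ u => comp (comp (trK (psiKS (ctrOff (d + 1) Lc) Lc)) (slotPsiS (ctrOff (d + 1) Lc) Lc
              (fun κ t => (cE * wE d Lc (j + 1)) • e3OfK Lc (coDressKBmAt (ctr (d + 1) Lc) Lc (KInvStep (d := d) Lc j))
                (fun κ u => comp (comp (trK (psiKS (ctrOff (d + 1) Lc) Lc)) (slotPsiS (ctrOff (d + 1) Lc) Lc (ScombOf (symTablesAn1S2 d Lc cΛt) cE cVH cΛ j) κ u))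
                  (psiKS (ctrOff (d + 1) Lc) Lc)) κ t) κ u)) (psiKS (ctrOff (d + 1) Lc) Lc))) ν u')
          yw.1 yw.2 (Sum.inl α) (Sum.inl β) =
      ∑ c ∈ box (d + 1) Lc, ∑' u' : Site (d + 1), ∑' yw : Site (d + 1) × Site (d + 1), (if yw.1 α % (Lc : ℤ) = (Lc : ℤ) - 1 then (1 : ℝ) else 0) * (if yw.2 β % (Lc : ℤ) = (Lc : ℤ) - 1 then (1 : ℝ) else 0) *
        comp (comp (vertexOfK (unitK sf sm (coDressKBmAt (ctr (d + 1) Lc) Lc (KInvStep (d := d) Lc (j + 1)))) Lc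
            (unitS sf sm (fun κ t => (cE * wE d Lc (j + 1)) • e3OfK Lc (coDressKBmAt (ctr (d + 1) Lc) Lc (KInvStep (d := d) Lc j))
                (fun κ u => comp (comp (trK (psiKS (ctrOff (d + 1) Lc) Lc)) (slotPsiS (ctrOff (d + 1) Lc) Lc (ScombOf (symTablesAn1S2 d Lc cΛt) cE cVH cΛ j) κ u))
                  (psiKS (ctrOff (d + 1) Lc) Lc)) κ t)) μ (toSite c))
          (unitK sf sm (coDressKBmAt (ctr (d + 1) Lc) Lc (KInvStep (d := d) Lc (j + 1)))))
          (vertexOfK (unitK sf sm (coDressKBmAt (ctr (d + 1) Lc) Lc (KInvStep (d := d) Lc (j + 1)))) Lc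
            (unitS sf sm (fun κ t => (cE * wE d Lc (j + 1)) • e3OfK Lc (coDressKBmAt (ctr (d + 1) Lc) Lc (KInvStep (d := d) Lc j))
                (fun κ u => comp (comp (trK (psiKS (ctrOff (d + 1) Lc) Lc)) (slotPsiS (ctrOff (d + 1) Lc) Lc (ScombOf (symTablesAn1S2 d Lc cΛt) cE cVH cΛ j) κ u))
                  (psiKS (ctrOff (d + 1) Lc) Lc)) κ t)) ν u')
          yw.1 yw.2 (Sum.inl α) (Sum.inl β) := by
  have hLc : 1 ≤ Lc := Nat.one_le_iff_ne_zero.mpr (NeZero.ne Lc)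
  obtain ⟨CM, δM, hδM, hM⟩ := exists_locStencil_transport_ScombOf (d := d) (Lc := Lc) cΛt cE cVH cΛ j
  exact sum_box_transported_sector_ee_word_eq (μ := μ) (ν := ν) (α := α) (β := β) hLc (ctrOff_mem_box (pos_Lc (Lc := Lc))) (ctrOff_mem_box (pos_Lc (Lc := Lc)))
    sf sm (cE * wE d Lc (j + 1)) j hM hδM (fun κ u t => transport_ScombOf_translate (d := d) (Lc := Lc) cΛt cE cVH cΛ j κ u t)

end Comb

end Summit.QuantumFields.BalabanUV.Beta.GAN24.CombEEWordTransferStep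

end
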